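import Literature.Geometry.Lorentzian.BoostedKerrSchildDecay
import HarnessLib

/-!
# The radiation zone of a chart converging to a superposition of boosted Kerr–Schild fields

Companion to `KerrConvergenceProofs.lean` (the one-hole-at-rest radiation zone,
`Spacetime.tendsto_deviationCk_backgroundOn`) and `BoostedKerrSchildDecay.lean` (family `gr`).
The `N`-black-hole final state picture (DHRT arXiv:2104.08222, §1; the hypothesis structure
`FinalStateDecomposition` of `KerrConvergence.lean`) certifies the region far from all holes by a
FLAT chart: the given late-time chart restricted to an open set `W` staying at rest-frame radius
`> ρ(x⁰) → ∞` from every centre. If the chart converges, in `Cᵏ` on the lab slabs `{x⁰ = τ}`, to a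
reference field whose perturbation is the superposition `∑ᵢ (boostedKerrBilin Λᵢ cᵢ Mᵢ aᵢ − η)`
(e.g. `multiCentreKerrSchildBilin`, Bonning et al. 2003, §3.3), then on `W` it converges to `η`:
`(Φ|_W)^* g − η = (Φ^* g − g₀) + ∑ᵢ (g_{Mᵢ,aᵢ,Λᵢ,cᵢ} − η)` and every term of the sum has all
derivatives `O(1/rᵢ)` (`norm_iteratedFDeriv_boostedKsPert_le`). Contents:

* `enorm_iteratedFDeriv_sum_le` — `‖D^m (∑ᵢ fᵢ)(x)‖ ≤ ∑ᵢ ‖D^m fᵢ(x)‖` for functions `Cᵐ` at `x`;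
* `Spacetime.deviation_eq_pullback_sub`, `Spacetime.deviation_backgroundOn_comp_inclusion_model`,
  `Spacetime.deviationExtend_backgroundOn_eventuallyEq_model`,
  `Spacetime.contDiffAt_deviationExtend_model` — the restriction/smoothness lemmas of
  `KerrConvergenceProofs` for an ARBITRARY `ModelBackground` (a literal `⟨U, b, t, r⟩`);
* `Spacetime.tendsto_deviationCk_backgroundOn_multiCentre` — the radiation-zone convergence.

## References

* M. Dafermos, G. Holzegel, I. Rodnianski, M. Taylor, arXiv:2104.08222, §1 (`arXiv210408222`).
* E. Bonning, P. Marronetti, D. Neilsen, R. Matzner, Phys. Rev. D 68 (2003) 044019, §3.3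
  (key `BonningEtAl2003`).
* R. P. Kerr, A. Schild, 1965, §3 (key `KerrSchild1965`).
-/

noncomputable section

open TopologicalSpace Manifold Filter Topology Set Function
open scoped ContDiff Topology ENNReal BigOperators

universe u

namespace Literature.Geometry.Lorentzian

/-! ### Iterated derivative of a finite sum -/

/-- **Iterated derivative of a finite sum** of functions `Cᵐ` at a point: in `‖·‖ₑ`,
`‖D^m (∑ᵢ fᵢ)(x)‖ ≤ ∑ᵢ ‖D^m fᵢ(x)‖` (Mathlib's `iteratedFDeriv_add_apply`, by induction on the
finite set). [folklore] -/
theorem enorm_iteratedFDeriv_sum_le {E' G : Type*} [NormedAddCommGroup E'] [NormedSpace ℝ E']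
    [NormedAddCommGroup G] [NormedSpace ℝ G] {ι : Type*} (s : Finset ι) {f : ι → E' → G} {x : E'}
    {m : ℕ} (hf : ∀ i ∈ s, ContDiffAt ℝ m (f i) x) :
    ‖iteratedFDeriv ℝ m (fun y ↦ ∑ i ∈ s, f i y) x‖ₑ ≤ ∑ i ∈ s, ‖iteratedFDeriv ℝ m (f i) x‖ₑ := by
  classical
  induction s using Finset.induction_on with
  | empty =>
    simp only [Finset.sum_empty]
    rw [iteratedFDeriv_fun_zero, Pi.zero_apply, ← ofReal_norm, ContinuousMultilinearMap.opNorm_zero,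
      ENNReal.ofReal_zero]
  | insert a s ha ih =>
    have hfa : ContDiffAt ℝ m (f a) x := hf a (Finset.mem_insert_self a s)
    have hfs : ∀ i ∈ s, ContDiffAt ℝ m (f i) x := fun i hi ↦ hf i (Finset.mem_insert_of_mem hi)
    have hsum : ContDiffAt ℝ m (fun y ↦ ∑ i ∈ s, f i y) x := ContDiffAt.sum fun i hi ↦ hfs i hi
    have hfun : (fun y ↦ ∑ i ∈ insert a s, f i y) = f a + fun y ↦ ∑ i ∈ s, f i y := by
      funext y
      rw [Finset.sum_insert ha]
      rfl
    rw [hfun, Finset.sum_insert ha]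
    exact (enorm_iteratedFDeriv_add_le hfa hsum).trans (add_le_add le_rfl (ih hfs))

/-! ### Restriction of a chart to a smaller open domain, over an arbitrary reference background -/

namespace Spacetime

variable (𝓢 : Spacetime.{u} 4)

/-- Unfolding of `Spacetime.deviation` as a difference of bilinear-form fields. [folklore] -/
theorem deviation_eq_pullback_sub (B : ModelBackground) (Ψ : B.domain → 𝓢.carrier)
    (x : B.domain) :
    𝓢.deviation B Ψ x =
      (show E4 →L[ℝ] E4 →L[ℝ] ℝ from
        pullbackBilin (I := 𝓡 4) (I' := 𝓘(ℝ, E4)) Ψ 𝓢.metric.val x) - B.bilin x.1 :=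
  rfl

/-- In a chart `Φ` on an ARBITRARY background `B`, restricted to an open `W ≤ B.domain`, the
deviation from the Minkowski background on `W` is the deviation from `B` plus `g₀ − η`:
`(Φ|_W)^* g − η = (Φ^* g − g₀) + (g₀ − η)` (chain rule along the inclusion, whose differential is
the identity). The Kerr-background case is `deviation_backgroundOn_comp_inclusion`
(DHRT arXiv:2104.08222, §1 for the deviation). [cite: arXiv210408222, §1] -/
theorem deviation_backgroundOn_comp_inclusion_model (B : ModelBackground) {W : Opens E4}
    (h : (Minkowski.backgroundOn W).domain ≤ B.domain)
    {Φ : B.domain → 𝓢.carrier} (hΦ : ContMDiff 𝓘(ℝ, E4) (𝓡 4) ∞ Φ)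
    (x : (Minkowski.backgroundOn W).domain) :
    𝓢.deviation (Minkowski.backgroundOn W) (Φ ∘ Opens.inclusion h) x =
      𝓢.deviation B Φ (Opens.inclusion h x) + (B.bilin x.1 - Minkowski.bilin) := by
  have hΦd : MDifferentiable 𝓘(ℝ, E4) (𝓡 4) Φ := hΦ.mdifferentiable (by simp)
  have hid : MDifferentiable 𝓘(ℝ, E4) 𝓘(ℝ, E4) (Opens.inclusion h) :=
    (contMDiff_inclusion (n := ∞) h).mdifferentiable (by simp)
  have hcomp := congrFun (pullbackBilin_comp (I' := 𝓘(ℝ, E4)) (I := 𝓘(ℝ, E4)) (I'' := 𝓡 4)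
    hΦd hid 𝓢.metric.val) x
  have e1 : ∀ v w : E4,
      pullbackBilin (I := 𝓡 4) (I' := 𝓘(ℝ, E4)) (Φ ∘ Opens.inclusion h) 𝓢.metric.val x v w =
        pullbackBilin (I := 𝓡 4) (I' := 𝓘(ℝ, E4)) Φ 𝓢.metric.val (Opens.inclusion h x) v w := by
    intro v w
    rw [hcomp, pullbackBilin_apply (f := Opens.inclusion h), OpensChart.mfderiv_inclusion_apply,
      OpensChart.mfderiv_inclusion_apply]
  have hb1 : (Minkowski.backgroundOn W).bilin x.1 = Minkowski.bilin := rfl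
  have hb2 : B.bilin (Opens.inclusion h x).1 = B.bilin x.1 := rfl
  rw [deviation_eq_pullback_sub, deviation_eq_pullback_sub, hb1, hb2]
  refine ContinuousLinearMap.ext fun v ↦ ContinuousLinearMap.ext fun w ↦ ?_
  rw [sub_apply, sub_apply, add_apply, add_apply, sub_apply, sub_apply, sub_apply, sub_apply,
    sub_add_sub_cancel]
  exact congrArg (fun r : ℝ ↦ r - Minkowski.bilin v w) (e1 v w)

/-- Extended-by-zero form of `deviation_backgroundOn_comp_inclusion_model`, as an eventual equality
near a point of `W` (DHRT arXiv:2104.08222, §1). [cite: arXiv210408222, §1] -/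
theorem deviationExtend_backgroundOn_eventuallyEq_model (B : ModelBackground) {W : Opens E4}
    (h : (Minkowski.backgroundOn W).domain ≤ B.domain)
    {Φ : B.domain → 𝓢.carrier} (hΦ : ContMDiff 𝓘(ℝ, E4) (𝓡 4) ∞ Φ) {z : E4} (hz : z ∈ W) :
    𝓢.deviationExtend (Minkowski.backgroundOn W) (Φ ∘ Opens.inclusion h) =ᶠ[𝓝 z]
      fun y ↦ 𝓢.deviationExtend B Φ y + (B.bilin y - Minkowski.bilin) := by
  filter_upwards [W.2.mem_nhds hz] with y hy
  have hy' : y ∈ (Minkowski.backgroundOn W).domain := hy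
  have e1 := 𝓢.deviationExtend_coe (Minkowski.backgroundOn W) (Φ ∘ Opens.inclusion h) ⟨y, hy'⟩
  have e2 := 𝓢.deviationExtend_coe B Φ (Opens.inclusion h ⟨y, hy'⟩)
  exact e1.trans ((𝓢.deviation_backgroundOn_comp_inclusion_model B h hΦ ⟨y, hy'⟩).trans
    (congrArg (· + (B.bilin y - Minkowski.bilin)) e2.symm))

/-- **The extended deviation `Φ^* g − g₀` of a smooth chart map is `C^∞` at every point of the
reference domain at which the reference field `g₀` is**: the pullback `Φ^* g` is a smooth section
of the bundle of bilinear forms (`contMDiff_pullbackBilin_holds`, O'Neill 1983, Ch. 3,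
Lemma 3.35 ff.), i.e. its components are smooth over the open subset of `E4`
(`OpensChart.contMDiffAt_bilinSection_iff`). The Kerr case is `contDiffAt_deviationExtend_kerr`.
[cite: ONeill1983, Ch. 3, Lemma 3.35] -/
theorem contDiffAt_deviationExtend_model (B : ModelBackground) {Φ : B.domain → 𝓢.carrier}
    (hΦ : ContMDiff 𝓘(ℝ, E4) (𝓡 4) ∞ Φ) (x : B.domain) (hb : ContDiffAt ℝ ∞ B.bilin x) :
    ContDiffAt ℝ ∞ (𝓢.deviationExtend B Φ) x := by
  have hsec := PseudoRiemannianMetric.contMDiff_pullbackBilin_holds (I := 𝓡 4) (M := 𝓢.carrier)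
    (I' := 𝓘(ℝ, E4)) (N := B.domain) (n := ∞) Φ hΦ 𝓢.metric.toPseudoRiemannianMetric
  have hGs : ContDiffAt ℝ ∞ (fun z ↦ 𝓢.deviationExtend B Φ z + B.bilin z) x := by
    refine (OpensChart.contMDiffAt_bilinSection_iff x
      (fun y ↦ pullbackBilin (I := 𝓡 4) (I' := 𝓘(ℝ, E4)) Φ 𝓢.metric.val y)
      (fun z ↦ 𝓢.deviationExtend B Φ z + B.bilin z) fun y ↦ ?_).1 (hsec x)
    have e : ∀ v w : E4, (𝓢.deviationExtend B Φ y + B.bilin y) v w =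
        (show E4 →L[ℝ] E4 →L[ℝ] ℝ from
          pullbackBilin (I := 𝓡 4) (I' := 𝓘(ℝ, E4)) Φ 𝓢.metric.val y) v w := by
      intro v w
      rw [add_apply, add_apply, 𝓢.deviationExtend_coe, deviation_eq_pullback_sub, sub_apply,
        sub_apply, sub_add_cancel]
    show (show E4 →L[ℝ] E4 →L[ℝ] ℝ from
        pullbackBilin (I := 𝓡 4) (I' := 𝓘(ℝ, E4)) Φ 𝓢.metric.val y) =
      𝓢.deviationExtend B Φ y + B.bilin y
    exact ContinuousLinearMap.ext fun v ↦ ContinuousLinearMap.ext fun w ↦ (e v w).symm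
  have hfun : 𝓢.deviationExtend B Φ =
      fun z ↦ (𝓢.deviationExtend B Φ z + B.bilin z) - B.bilin z := by
    funext z
    exact (add_sub_cancel_right (𝓢.deviationExtend B Φ z) (B.bilin z)).symm
  rw [hfun]
  exact hGs.sub hb

/-! ### The radiation zone of a multi-centre chart -/

-- the algebraic and the operator-norm instance paths on `E4 →L[ℝ] E4 →L[ℝ] ℝ` unify slowly
set_option synthInstance.maxHeartbeats 200000 in
/-- **The radiation zone of a superposition converges to Minkowski space.** Let `Φ` be a smooth
chart on a background `B` with lab time `x⁰`, whose reference field has the multi-centre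
perturbation `g₀ − η = ∑ᵢ (boostedKerrBilin Λᵢ cᵢ Mᵢ aᵢ − η)` (e.g. `multiCentreKerrSchildBilin`), and
whose `Cᵏ` deviation on the lab slabs tends to `0`. If `W ≤ B.domain` is open and its slice at
time `τ` lies at rest-frame radius `> ρ(τ)` from EVERY centre, with `ρ → ∞`, then the `Cᵏ`
deviation of `Φ|_W` from `η` on the slabs of `W` tends to `0`:
`(Φ|_W)^* g − η = (Φ^* g − g₀) + ∑ᵢ (g_{Mᵢ,aᵢ,Λᵢ,cᵢ} − η)`, and `‖D^m (g_{Mᵢ,aᵢ,Λᵢ,cᵢ} − η)‖ ≤ Cᵢ / rᵢ ≤ C / ρ(τ)`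
there (`norm_iteratedFDeriv_boostedKsPert_le`). The case of one hole at rest is
`tendsto_deviationCk_backgroundOn` (DHRT arXiv:2104.08222, §1, radiation zone of the final-state
picture; the superposed reference field is that of Bonning et al. 2003, §3.3).
[cite: arXiv210408222, §1] -/
theorem tendsto_deviationCk_backgroundOn_multiCentre {N : ℕ} {M a : Fin N → ℝ}
    {Λ : Fin N → lorentzGroup} {c : Fin N → E4} {k : ℕ} (B : ModelBackground)
    (hBb : ∀ x, B.bilin x - Minkowski.bilin =
      ∑ i, (boostedKerrBilin (Λ i) (c i) (M i) (a i) x - Minkowski.bilin))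
    (hBt : ∀ x, B.time x = x 0) {W : Opens E4}
    {Φ : B.domain → 𝓢.carrier} (hΦ : ContMDiff 𝓘(ℝ, E4) (𝓡 4) ∞ Φ)
    (ht : Tendsto (fun τ ↦ 𝓢.deviationCk B Φ k τ) atTop (𝓝 0))
    {ρ : ℝ → ℝ} (hρ : Tendsto ρ atTop atTop)
    (hW : ∀ z ∈ W, ∀ i, ρ (z 0) < Kerr.radius (a i) (poincareInv (Λ i) (c i) z))
    (h : (Minkowski.backgroundOn W).domain ≤ B.domain) :
    Tendsto (fun τ ↦ 𝓢.deviationCk (Minkowski.backgroundOn W) (Φ ∘ Opens.inclusion h) k τ)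
      atTop (𝓝 0) := by
  have hBfun : ∀ x, B.bilin x = Minkowski.bilin +
      ∑ i, (boostedKerrBilin (Λ i) (c i) (M i) (a i) x - Minkowski.bilin) := fun x ↦ by
    rw [← hBb x]
    abel
  choose C R hR hCR using fun i m ↦ norm_iteratedFDeriv_boostedKsPert_le (Λ i) (c i) (M i) (a i) m
  set Cmax : ℝ := ∑ i, ∑ m ∈ Finset.range (k + 1), |C i m| with hCmax
  set Rmax : ℝ := 1 + ∑ i, ∑ m ∈ Finset.range (k + 1), R i m with hRmax
  have hCm : ∀ i, ∀ m ≤ k, |C i m| ≤ Cmax := fun i m hm ↦ by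
    have h1 : |C i m| ≤ ∑ m ∈ Finset.range (k + 1), |C i m| :=
      Finset.single_le_sum (f := fun m ↦ |C i m|) (fun _ _ ↦ abs_nonneg _)
        (Finset.mem_range.mpr (Nat.lt_succ_of_le hm))
    exact h1.trans (Finset.single_le_sum (f := fun i ↦ ∑ m ∈ Finset.range (k + 1), |C i m|)
      (fun _ _ ↦ Finset.sum_nonneg fun _ _ ↦ abs_nonneg _) (Finset.mem_univ i))
  have hRm : ∀ i, ∀ m ≤ k, R i m ≤ Rmax := fun i m hm ↦ by
    have h1 : R i m ≤ ∑ m ∈ Finset.range (k + 1), R i m :=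
      Finset.single_le_sum (f := fun m ↦ R i m) (fun m _ ↦ (hR i m).le)
        (Finset.mem_range.mpr (Nat.lt_succ_of_le hm))
    have h2 : ∑ m ∈ Finset.range (k + 1), R i m ≤ ∑ i, ∑ m ∈ Finset.range (k + 1), R i m :=
      Finset.single_le_sum (f := fun i ↦ ∑ m ∈ Finset.range (k + 1), R i m)
        (fun _ _ ↦ Finset.sum_nonneg fun m _ ↦ (hR _ m).le) (Finset.mem_univ i)
    linarith
  have hRmax0 : 0 < Rmax := by
    have : 0 ≤ ∑ i, ∑ m ∈ Finset.range (k + 1), R i m :=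
      Finset.sum_nonneg fun i _ ↦ Finset.sum_nonneg fun m _ ↦ (hR i m).le
    linarith
  have hCmax0 : 0 ≤ Cmax := Finset.sum_nonneg fun _ _ ↦ Finset.sum_nonneg fun _ _ ↦ abs_nonneg _
  have hbound : ∀ τ, Rmax ≤ ρ τ →
      𝓢.deviationCk (Minkowski.backgroundOn W) (Φ ∘ Opens.inclusion h) k τ ≤
        𝓢.deviationCk B Φ k τ + (N : ℝ≥0∞) * ENNReal.ofReal (Cmax / ρ τ) := by
    intro τ hτ
    refine iSup₂_le fun m hm ↦ iSup₂_le fun z hz ↦ ?_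
    obtain ⟨x, hx, rfl⟩ := hz
    have hxW : (x : E4) ∈ W := x.2
    have hx0 : (x : E4) 0 = τ := hx
    have hρpos : 0 < ρ τ := hRmax0.trans_le hτ
    have hrad : ∀ i, ρ τ < Kerr.radius (a i) (poincareInv (Λ i) (c i) x) := fun i ↦
      hx0 ▸ hW x hxW i
    have hr0 : ∀ i, 0 < Kerr.radius (a i) (poincareInv (Λ i) (c i) x) := fun i ↦
      hρpos.trans (hrad i)
    have hfi : ∀ i, ContDiffAt ℝ ∞
        (fun y ↦ boostedKerrBilin (Λ i) (c i) (M i) (a i) y - Minkowski.bilin) x := fun i ↦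
      contDiffAt_boostedKsPert (hr0 i)
    have hb : ContDiffAt ℝ ∞ B.bilin (Opens.inclusion h x) := by
      rw [show B.bilin = fun x ↦ Minkowski.bilin +
        ∑ i, (boostedKerrBilin (Λ i) (c i) (M i) (a i) x - Minkowski.bilin) from funext hBfun]
      exact contDiffAt_const.add (ContDiffAt.sum fun i _ ↦ hfi i)
    have h1 : ContDiffAt ℝ m (𝓢.deviationExtend B Φ) x :=
      (𝓢.contDiffAt_deviationExtend_model B hΦ (Opens.inclusion h x) hb).of_le
        (by exact_mod_cast le_top)
    have h2 : ContDiffAt ℝ m (fun y ↦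
        ∑ i, (boostedKerrBilin (Λ i) (c i) (M i) (a i) y - Minkowski.bilin)) x :=
      ContDiffAt.sum fun i _ ↦ (hfi i).of_le (by exact_mod_cast le_top)
    have hev := 𝓢.deviationExtend_backgroundOn_eventuallyEq_model B h hΦ hxW
    have hev' : 𝓢.deviationExtend (Minkowski.backgroundOn W) (Φ ∘ Opens.inclusion h) =ᶠ[𝓝 (x : E4)]
        fun y ↦ 𝓢.deviationExtend B Φ y +
          ∑ i, (boostedKerrBilin (Λ i) (c i) (M i) (a i) y - Minkowski.bilin) :=
      hev.trans (Eventually.of_forall fun y ↦ by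
        show 𝓢.deviationExtend B Φ y + (B.bilin y - Minkowski.bilin) = _
        rw [hBb])
    rw [(hev'.iteratedFDeriv ℝ m).eq_of_nhds]
    change ‖iteratedFDeriv ℝ m (𝓢.deviationExtend B Φ +
      fun y ↦ ∑ i, (boostedKerrBilin (Λ i) (c i) (M i) (a i) y - Minkowski.bilin)) x‖ₑ ≤ _
    have hmem : (x : E4) ∈ Subtype.val '' B.timeSlab τ :=
      ⟨Opens.inclusion h x, (hBt x).trans hx0, rfl⟩
    refine (enorm_iteratedFDeriv_add_le h1 h2).trans (add_le_add ?_ ?_)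
    · exact enorm_iteratedFDeriv_le_supCkENorm hm hmem _
    · refine (enorm_iteratedFDeriv_sum_le Finset.univ fun i _ ↦
        (hfi i).of_le (by exact_mod_cast le_top)).trans ?_
      have hi : ∀ i, ‖iteratedFDeriv ℝ m
          (fun y ↦ boostedKerrBilin (Λ i) (c i) (M i) (a i) y - Minkowski.bilin) x‖ₑ ≤
          ENNReal.ofReal (Cmax / ρ τ) := fun i ↦ by
        refine enorm_le_ofReal_of_norm_le ?_
        have hRle : R i m ≤ Kerr.radius (a i) (poincareInv (Λ i) (c i) x) :=
          ((hRm i m hm).trans hτ).trans (hrad i).le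
        calc (‖iteratedFDeriv ℝ m
              (fun y ↦ boostedKerrBilin (Λ i) (c i) (M i) (a i) y - Minkowski.bilin) x‖ : ℝ)
            ≤ C i m / Kerr.radius (a i) (poincareInv (Λ i) (c i) x) := hCR i m x hRle
          _ ≤ Cmax / Kerr.radius (a i) (poincareInv (Λ i) (c i) x) :=
            div_le_div_of_nonneg_right ((le_abs_self _).trans (hCm i m hm)) (hr0 i).le
          _ ≤ Cmax / ρ τ := div_le_div_of_nonneg_left hCmax0 hρpos (hrad i).le
      calc ∑ i, ‖iteratedFDeriv ℝ m
            (fun y ↦ boostedKerrBilin (Λ i) (c i) (M i) (a i) y - Minkowski.bilin) x‖ₑ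
          ≤ ∑ _i : Fin N, ENNReal.ofReal (Cmax / ρ τ) := Finset.sum_le_sum fun i _ ↦ hi i
        _ = (N : ℝ≥0∞) * ENNReal.ofReal (Cmax / ρ τ) := by
          rw [Finset.sum_const, Finset.card_univ, Fintype.card_fin, nsmul_eq_mul]
  have hlim : Tendsto (fun τ ↦ 𝓢.deviationCk B Φ k τ +
      (N : ℝ≥0∞) * ENNReal.ofReal (Cmax / ρ τ)) atTop (𝓝 0) := by
    have h2 : Tendsto (fun τ ↦ Cmax / ρ τ) atTop (𝓝 0) := tendsto_const_nhds.div_atTop hρ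
    have h3 : Tendsto (fun τ ↦ (N : ℝ≥0∞) * ENNReal.ofReal (Cmax / ρ τ)) atTop (𝓝 0) := by
      have h4 := ENNReal.Tendsto.const_mul (ENNReal.tendsto_ofReal h2)
        (Or.inr (ENNReal.natCast_ne_top N))
      simpa using h4
    simpa using ht.add h3
  refine tendsto_of_tendsto_of_tendsto_of_le_of_le' tendsto_const_nhds hlim
    (Eventually.of_forall fun _ ↦ zero_le) ?_
  filter_upwards [hρ.eventually_ge_atTop Rmax] with τ hτ
  exact hbound τ hτ

end Spacetime

end Literature.Geometry.Lorentzian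

end
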